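import Mathlib
import Summits.ValiantsHypothesis.ValiantsHypothesis.Theorems.ElementaryWordLengthWordLengthQPStubKappaTwoStructureAux
import Summits.ValiantsHypothesis.ValiantsHypothesis.Theorems.ElementaryWordLengthWordLengthQPStubKappaTwoStructureAuxB

/-!
# Crux `WordLengthQP` (stmt-ValiantsHypothesis-6623), line `positive-monoid-exits` —
helpers for stub `stub_kappaTwoStructure`, part C: the placement lemma.

`k2_placement`: if `E_{i₁j₁}(a) (S Q S) E_{i₂j₂}(b) = M ≥ E₀₂(F)` coefficientwise with `Q` a tame
stretch, `a`, `b` of total degree `≤ 1` and `F ≥ 0` with a monomial of degree `≥ 3`, then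
`(i₁, j₂) = (1, 1)`.  The eight other placements die because an adjacent position outside
row `i₁` and column `j₂` carries the entry `-Q_{ij} ≤ 0`, so `Q` has no letter of that type,
and then `M₀₂` has total degree `≤ 2` (TRIAGE-r2-1 of the crux, verified).
-/

set_option linter.dupNamespace false

noncomputable section

namespace Summit.ValiantsHypothesis.ValiantsHypothesis.Cruxes.WordLengthQP.PositiveMonoidExits

open MvPolynomial

/-- Degree bookkeeping: a polynomial of total degree `≤ 2` cannot dominate a positive coefficient
of `F` at a monomial of degree `≥ 3`. [folklore] -/
theorem k2_tD_absurd {σ : Type} (F p : MvPolynomial σ ℝ) (m₀ : σ →₀ ℕ) (hm₀ : 3 ≤ m₀.degree)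
    (hFm₀ : 0 < F.coeff m₀) (hp : p.totalDegree ≤ 2) (hle : F.coeff m₀ ≤ p.coeff m₀) : False := by
  have h3 : p.totalDegree < m₀.degree := by omega
  have : p.coeff m₀ = 0 := MvPolynomial.coeff_eq_zero_of_totalDegree_lt h3
  linarith

/-- `S X S` of a matrix with column `2` equal to `e₂` has column `2` equal to `e₂`. [folklore] -/
theorem k2_SXS_col2 {σ : Type} (Q : Matrix (Fin 3) (Fin 3) (MvPolynomial σ ℝ))
    (h : ∀ i, Q i 2 = if i = 2 then 1 else 0) (i : Fin 3) :
    (Matrix.diagonal ![(1 : MvPolynomial σ ℝ), -1, 1] * Q * Matrix.diagonal ![(1 : MvPolynomial σ ℝ), -1, 1]) i 2 = if i = 2 then 1 else 0 := by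
  rw [k2_SXS_apply, h]; fin_cases i <;> simp

/-- `S X S` of a matrix with row `0` equal to `e₀` has row `0` equal to `e₀`. [folklore] -/
theorem k2_SXS_row0 {σ : Type} (Q : Matrix (Fin 3) (Fin 3) (MvPolynomial σ ℝ))
    (h : ∀ j, Q 0 j = if j = 0 then 1 else 0) (j : Fin 3) :
    (Matrix.diagonal ![(1 : MvPolynomial σ ℝ), -1, 1] * Q * Matrix.diagonal ![(1 : MvPolynomial σ ℝ), -1, 1]) 0 j = if j = 0 then 1 else 0 := by
  rw [k2_SXS_apply, h]; fin_cases j <;> simp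

/-- **The placement lemma.** If `E_{i₁j₁}(a) (S Q S) E_{i₂j₂}(b) = M ≥ E₀₂(F)` coefficientwise with
`Q` a tame stretch, `a`, `b` of total degree `≤ 1`, `F ≥ 0` with a monomial of degree `≥ 3`, then
`(i₁, j₂) = (1, 1)`: for every other placement an adjacent position outside row `i₁` and column
`j₂` has `M`-entry `-Q ≤ 0`, so `Q` has no letter of that type, and then `M₀₂` has total degree
`≤ 2` (TRIAGE-r2-1 of the crux, verified here). [folklore] -/
theorem k2_placement {σ : Type} (F : MvPolynomial σ ℝ) (hpos : ∀ m, 0 ≤ F.coeff m)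
    (m₀ : σ →₀ ℕ) (hm₀ : 3 ≤ m₀.degree) (hFm₀ : 0 < F.coeff m₀)
    (q : List (Fin 3 × Fin 3 × ℝ × Option σ)) (hq : ∀ l ∈ q, ((0 < Prod.fst (Prod.snd (Prod.snd l)) ∧ (Fin.val (Prod.fst l) + 1 = Fin.val (Prod.fst (Prod.snd l)) ∨ Fin.val (Prod.fst (Prod.snd l)) + 1 = Fin.val (Prod.fst l))) ∨ Prod.fst (Prod.snd (Prod.snd l)) = 0))
    (i₁ j₁ i₂ j₂ : Fin 3) (hv1 : i₁ ≠ j₁) (hv2 : i₂ ≠ j₂) (a b : MvPolynomial σ ℝ)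
    (ha : a.totalDegree ≤ 1) (hb : b.totalDegree ≤ 1)
    (M : Matrix (Fin 3) (Fin 3) (MvPolynomial σ ℝ))
    (hME : ∀ i j m, ((Matrix.transvection (0 : Fin 3) 2 F) i j).coeff m ≤ (M i j).coeff m)
    (hM : Matrix.transvection i₁ j₁ a * (Matrix.diagonal ![(1 : MvPolynomial σ ℝ), -1, 1] * (q.map (fun l => (Matrix.transvection (Prod.fst l) (Prod.fst (Prod.snd l)) (MvPolynomial.C (Prod.fst (Prod.snd (Prod.snd l))) * Option.elim (Prod.snd (Prod.snd (Prod.snd l))) 1 MvPolynomial.X) : Matrix (Fin 3) (Fin 3) (MvPolynomial σ ℝ)))).prod * Matrix.diagonal ![(1 : MvPolynomial σ ℝ), -1, 1]) *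
      Matrix.transvection i₂ j₂ b = M) :
    i₁ = 1 ∧ j₂ = 1 := by
  set Q := (q.map (fun l => (Matrix.transvection (Prod.fst l) (Prod.fst (Prod.snd l)) (MvPolynomial.C (Prod.fst (Prod.snd (Prod.snd l))) * Option.elim (Prod.snd (Prod.snd (Prod.snd l))) 1 MvPolynomial.X) : Matrix (Fin 3) (Fin 3) (MvPolynomial σ ℝ)))).prod with hQdef
  set X := Matrix.diagonal ![(1 : MvPolynomial σ ℝ), -1, 1] * Q * Matrix.diagonal ![(1 : MvPolynomial σ ℝ), -1, 1] with hXdef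
  have hM0 : ∀ i j m, 0 ≤ (M i j).coeff m := fun i j m =>
    (k2_far_nonneg F hpos i j m).trans (hME i j m)
  have hunc : ∀ i j, i ≠ i₁ → j ≠ j₂ → M i j = X i j := by
    intro i j hi hj
    rw [← hM, Matrix.mul_transvection_apply_of_ne _ _ _ _ hj,
      Matrix.transvection_mul_apply_of_ne _ _ _ _ hi]
  -- an uncovered adjacent position carries no letter
  have hgen : ∀ i j : Fin 3, i ≠ j →
      (![(1 : MvPolynomial σ ℝ), -1, 1] i * ![(1 : MvPolynomial σ ℝ), -1, 1] j = -1) →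
      i ≠ i₁ → j ≠ j₂ → ∀ l ∈ q, l.1 = i → l.2.1 = j → l.2.2.1 = 0 := by
    intro i j hij hs hi hj
    refine k2_no_letter q hq i j hij fun m => ?_
    have h1 := hM0 i j m
    rw [hunc i j hi hj, hXdef, k2_SXS_apply] at h1
    have : ![(1 : MvPolynomial σ ℝ), -1, 1] i * Q i j * ![(1 : MvPolynomial σ ℝ), -1, 1] j =
        -(Q i j) := by
      rw [mul_comm _ (Q i j), mul_assoc, hs]; ring
    rw [this, MvPolynomial.coeff_neg] at h1
    linarith
  have hF02 : F.coeff m₀ ≤ (M 0 2).coeff m₀ := by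
    have := hME 0 2 m₀; simpa [Matrix.transvection] using this
  have hM02 : M 0 2 = X 0 2 + (if i₁ = 0 then a * X j₁ 2 else 0) +
      (if j₂ = 2 then b * X 0 i₂ else 0) + (if i₁ = 0 ∧ j₂ = 2 then a * b * X j₁ i₂ else 0) := by
    rw [← hM, hXdef, k2_TXT_apply02]
  have tD1 : (1 : MvPolynomial σ ℝ).totalDegree = 0 := MvPolynomial.totalDegree_one
  have tD0 : (0 : MvPolynomial σ ℝ).totalDegree = 0 := MvPolynomial.totalDegree_zero
  by_contra h11
  -- shape facts, available when the corresponding positions are uncovered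
  have noX2 : (1 : Fin 3) ≠ i₁ → (2 : Fin 3) ≠ j₂ → ∀ i, X i 2 = if i = 2 then 1 else 0 :=
    fun hi hj => k2_SXS_col2 Q (k2_col2_trivial q hq (hgen 1 2 (by decide) (by simp) hi hj))
  have noX1 : (0 : Fin 3) ≠ i₁ → (1 : Fin 3) ≠ j₂ → ∀ j, X 0 j = if j = 0 then 1 else 0 :=
    fun hi hj => k2_SXS_row0 Q (k2_row0_trivial q hq (hgen 0 1 (by decide) (by simp) hi hj))
  refine k2_tD_absurd F (M 0 2) m₀ hm₀ hFm₀ ?_ hF02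
  rw [hM02]
  have three : ∀ i : Fin 3, i = 0 ∨ i = 1 ∨ i = 2 := by decide
  have tDa1 : (a * 1).totalDegree ≤ 2 := by rw [mul_one]; omega
  have tDb1 : (b * 1).totalDegree ≤ 2 := by rw [mul_one]; omega
  have tadd : ∀ p r : MvPolynomial σ ℝ, p.totalDegree ≤ 2 → r.totalDegree ≤ 2 →
      (p + r).totalDegree ≤ 2 := fun p r hp hr =>
    (MvPolynomial.totalDegree_add _ _).trans (max_le hp hr)
  have tmul : ∀ p r : MvPolynomial σ ℝ, p.totalDegree ≤ 1 → r.totalDegree ≤ 1 →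
      (p * r).totalDegree ≤ 2 := fun p r hp hr =>
    (MvPolynomial.totalDegree_mul _ _).trans (by omega)
  have tzero : (0 : MvPolynomial σ ℝ).totalDegree ≤ 2 := by rw [tD0]; omega
  rcases three i₁ with rfl | rfl | rfl <;> rcases three j₂ with rfl | rfl | rfl
  · -- (0,0): no x₂
    have h := noX2 (by decide) (by decide)
    have X02 : X 0 2 = 0 := by simpa using h 0
    have X12 : X 1 2 = 0 := by simpa using h 1
    have X22 : X 2 2 = 1 := by simpa using h 2
    rw [if_pos rfl, if_neg (by decide), if_neg (by decide), add_zero, add_zero, X02, zero_add]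
    rcases three j₁ with rfl | rfl | rfl
    · exact absurd rfl hv1
    · rw [X12, mul_zero]; exact tzero
    · rw [X22]; exact tDa1
  · -- (0,1): no x₂
    have h := noX2 (by decide) (by decide)
    have X02 : X 0 2 = 0 := by simpa using h 0
    have X12 : X 1 2 = 0 := by simpa using h 1
    have X22 : X 2 2 = 1 := by simpa using h 2
    rw [if_pos rfl, if_neg (by decide), if_neg (by decide), add_zero, add_zero, X02, zero_add]
    rcases three j₁ with rfl | rfl | rfl
    · exact absurd rfl hv1
    · rw [X12, mul_zero]; exact tzero
    · rw [X22]; exact tDa1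
  · -- (0,2): upper shape
    obtain ⟨h10, h20, h21, h00, h11', h22, d01, d12, d02⟩ := k2_upper_shape q hq
      (hgen 1 0 (by decide) (by simp) (by decide) (by decide))
      (hgen 2 1 (by decide) (by simp) (by decide) (by decide))
    have x10 : X 1 0 = 0 := by rw [hXdef, k2_SXS_apply, show Q 1 0 = 0 from h10]; ring
    have x20 : X 2 0 = 0 := by rw [hXdef, k2_SXS_apply, show Q 2 0 = 0 from h20]; ring
    have x21 : X 2 1 = 0 := by rw [hXdef, k2_SXS_apply, show Q 2 1 = 0 from h21]; ring
    have x00 : X 0 0 = 1 := by rw [hXdef, k2_SXS_apply, show Q 0 0 = 1 from h00]; simp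
    have x11 : X 1 1 = 1 := by rw [hXdef, k2_SXS_apply, show Q 1 1 = 1 from h11']; simp
    have x22 : X 2 2 = 1 := by rw [hXdef, k2_SXS_apply, show Q 2 2 = 1 from h22]; simp
    have x01 : (X 0 1).totalDegree ≤ 1 := by
      have : X 0 1 = -(Q 0 1) := by rw [hXdef, k2_SXS_apply]; simp
      rw [this, MvPolynomial.totalDegree_neg]; exact d01
    have x12 : (X 1 2).totalDegree ≤ 1 := by
      have : X 1 2 = -(Q 1 2) := by rw [hXdef, k2_SXS_apply]; simp
      rw [this, MvPolynomial.totalDegree_neg]; exact d12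
    have x02 : (X 0 2).totalDegree ≤ 2 := by
      have : X 0 2 = Q 0 2 := by rw [hXdef, k2_SXS_apply]; simp
      rw [this]; exact d02
    rw [if_pos rfl, if_pos rfl, if_pos ⟨rfl, rfl⟩]
    rcases three j₁ with rfl | rfl | rfl
    · exact absurd rfl hv1
    · rcases three i₂ with rfl | rfl | rfl
      · rw [x10, x00, mul_zero, add_zero]
        exact tadd _ _ (tadd _ _ x02 (tmul _ _ ha x12)) tDb1
      · rw [x11, mul_one]
        exact tadd _ _ (tadd _ _ (tadd _ _ x02 (tmul _ _ ha x12)) (tmul _ _ hb x01)) (tmul _ _ ha hb)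
      · exact absurd rfl hv2
    · rcases three i₂ with rfl | rfl | rfl
      · rw [x22, x00, x20, mul_zero, add_zero]
        exact tadd _ _ (tadd _ _ x02 tDa1) tDb1
      · rw [x22, x21, mul_zero, add_zero]
        exact tadd _ _ (tadd _ _ x02 tDa1) (tmul _ _ hb x01)
      · exact absurd rfl hv2
  · -- (1,0): no x₁
    have h := noX1 (by decide) (by decide)
    have X02 : X 0 2 = 0 := by simpa using h 2
    rw [if_neg (by decide), if_neg (by decide), if_neg (by decide), add_zero, add_zero, add_zero, X02]
    exact tzero
  · exact absurd ⟨rfl, rfl⟩ h11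
  · -- (1,2): no x₁
    have h := noX1 (by decide) (by decide)
    have X02 : X 0 2 = 0 := by simpa using h 2
    have X00 : X 0 0 = 1 := by simpa using h 0
    have X01 : X 0 1 = 0 := by simpa using h 1
    rw [if_neg (by decide), if_pos rfl, if_neg (by decide), add_zero, add_zero, X02, zero_add]
    rcases three i₂ with rfl | rfl | rfl
    · rw [X00]; exact tDb1
    · rw [X01, mul_zero]; exact tzero
    · exact absurd rfl hv2
  · -- (2,0): no x₁
    have h := noX1 (by decide) (by decide)
    have X02 : X 0 2 = 0 := by simpa using h 2
    rw [if_neg (by decide), if_neg (by decide), if_neg (by decide), add_zero, add_zero, add_zero, X02]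
    exact tzero
  · -- (2,1): no x₂
    have h := noX2 (by decide) (by decide)
    have X02 : X 0 2 = 0 := by simpa using h 0
    rw [if_neg (by decide), if_neg (by decide), if_neg (by decide), add_zero, add_zero, add_zero, X02]
    exact tzero
  · -- (2,2): no x₁
    have h := noX1 (by decide) (by decide)
    have X02 : X 0 2 = 0 := by simpa using h 2
    have X00 : X 0 0 = 1 := by simpa using h 0
    have X01 : X 0 1 = 0 := by simpa using h 1
    rw [if_neg (by decide), if_pos rfl, if_neg (by decide), add_zero, add_zero, X02, zero_add]
    rcases three i₂ with rfl | rfl | rfl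
    · rw [X00]; exact tDb1
    · rw [X01, mul_zero]; exact tzero
    · exact absurd rfl hv2

end Summit.ValiantsHypothesis.ValiantsHypothesis.Cruxes.WordLengthQP.PositiveMonoidExits

end
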